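import Mathlib
import HarnessLib
import Literature.Analysis.FluidPDE.Tao2016AveragedNS.BoundedEternalSolutions
import Summits.NavierStokesRegularity.NavierStokesRegularity.Theorems.TaoLadderRungTwoBreakBlowupRigidityOneTypeIEternalLimit
import Summits.NavierStokesRegularity.NavierStokesRegularity.Theorems.TaoLadderRungTwoBreakBlowupRigidityOneRenormalisedViscousFlow
import Summits.NavierStokesRegularity.NavierStokesRegularity.Theorems.TaoLadderRungTwoBreakBlowupRigidityOneViscousLawClosure

/-!
# Crux `TaoLadderRungTwoBreak.EternalRigidityViscBddOne` (stmt-NavierStokesRegularity-20420): TYPE I ⟹ A NON-TRIVIAL UNIFORMLY BOUNDED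
# SOLUTION OF THE VISCOUS ETERNAL LAW ON ALL OF `ℝ` — the ω-limit of the (ω4) extraction exists and solves `IsEternalVisc ε₀ ν̂ α`'s
# law for some `ν̂ ∈ [0, K₁]` (KNSS one model down, law-only, VISCOUS; the `ν > 0` twin of `BlowupRigidityOne.TypeIEternalLimit`)

MODEL lattice ODEs only (Tao 2016 §4: the exact NS-scaled `ν`-viscous cascade lattice of a table of `InTableClass R`, `m = 4`, from a
one-shell datum, in the registered vocabulary `ViscousUpTo` / `BlowsUpAt` / `TypeOne` of the skeleton `85fbfe8e90eea58b`, and the self-similar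
variables of §6.4); nothing here is a statement about the Navier–Stokes equations; no stub, crux or summit is closed
(`--supports stmt-NavierStokesRegularity-20420`).

THE POINT.  The registered stub (ω4) `stub_eternalLimitViscBdd` asks: `ViscousUpTo ∧ BlowsUpAt ∧ TypeOne ⟹ ∃ ν̂ W, IsEternalVisc ε₀ ν̂ α W ∧
UniformBound W ∧ EternalSurvivingFwd 1 ε₀ W`.  This file builds the candidate `W` and proves everything EXCEPT the admissibility clauses
(`action`, `bdd`) of `IsEternalVisc` and the (S₁)-survival:
* `renormalisedViscousFlow_deriv_bound` / `renormalisedViscousFlow_lipschitz_of_typeI` — under type I the renormalisation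
  `W̃_n(σ) = Λ^n e^{−σ}X_n(T − e^{−σ})` of a viscous flow has `‖W̃_n'(σ)‖ ≤ K + ν(1+ε₀)^{2n}e^{−σ}C` on the half-line (viscous twin of
  `renormalisedFlow_deriv_bound`);
* `viscousEternalLawLimit_of_typeI` — **ω-LIMITS EXIST AND SOLVE THE VISCOUS LAW**: for shell/log-time centres `(d_j, s_j)`, `s_j → ∞`, whose
  FRAME VISCOSITIES `ν(1+ε₀)^{2d_j}e^{−s_j}` lie in `[0,K₁]`, a subsequence of the translates `W̃_{n+d_j}(u+s_j)` converges continuously to a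
  `W` solving the law of `IsEternalVisc ε₀ ν̂ α` at EVERY `σ ∈ ℝ` for some `ν̂ ∈ [0,K₁]`, with `‖W_n(σ)‖ ≤ C`
  (`exists_subseq_continuousLimit_param` + `viscousLaw_of_perturbedLimit_local`, the perturbation `(ν̂ − ν̂_j)(1+ε₀)^{2n}e^{−u}•W̃` dying locally
  uniformly);
* (part 2/2, `…ViscousTypeIKNSS`) `nontrivialViscousEternalLaw_of_typeOne` — **in the skeleton's vocabulary**: `ViscousUpTo ε₀ ν α X₀ X t⋆ ∧ BlowsUpAt ε₀ X t⋆ ∧ TypeOne ε₀ X t⋆`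
  (table of `InTableClass R`, `ν > 0`) ⟹ `∃ ν̂ ∈ [0,K₁], ∃ W : ℤ → ℝ → ℝ⁴` solving the law of `IsEternalVisc ε₀ ν̂ α` on all of `ℝ`,
  `UniformBound W`, and `‖W_0(0)‖ ≥ 1/(32(3+Λ)) > 0` — centring on the CRITICAL FRONT (`CriticalRate.typeOne_quantity_lower_bound`), whose frame
  viscosities are `< K₁` by the upper clock `FrontClock.frontClock_of_typeOne`.
HONEST LABEL: what remains of (ω4) is exactly the admissibility (`action`, `bdd`) and the (S₁)-survival of this `W` — the clock-type part
(uniform critical action along the blow-up); (ω3) (type I itself), ⟨20420⟩ and every NS statement remain OPEN; rung 0.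
-/

noncomputable section

-- the summit and its single sub-problem share the name (CONVENTIONS §1)
set_option linter.dupNamespace false

open Set Filter Topology
open Literature.Analysis.FluidPDE Literature.Analysis.FluidPDE.TaoCascade
open Summit.NavierStokesRegularity.NavierStokesRegularity.Theorems.BlowupRigidityOne
open Summit.NavierStokesRegularity.NavierStokesRegularity.Cruxes.MinimalBlowupExtraction.Extraction
  (exists_subseq_continuousLimit_param)

namespace Summit.NavierStokesRegularity.NavierStokesRegularity.Theorems.EternalRigidityViscBddOne.ViscousLawLimit

variable {m : ℕ}

/-! ### Type I ⇒ bounded derivatives of the renormalised VISCOUS flow on the half-line -/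

/-- **TYPE I ⇒ BOUNDED LOG-TIME DERIVATIVES (viscous flow).**  Let `X` solve the exact `ν`-viscous lattice on `[0,T)` (`C¹`, one-sided
motion law), `W` its renormalisation around `T`, `ν ≥ 0`, and assume the type-I bound `Λ^n(T−t)‖x_n(t)‖ ≤ C`.  Then at every `σ` with
`e^{−σ} < T`: `‖W_n'(σ)‖ ≤ C + (s₀₀₀ + Λs₀₀₁)C² + Λ⁻¹(s₁₀₀ + s₀₁₀)C² + ν(1+ε₀)^{2n}e^{−σ}·C` (the law `renormalisedViscousFlow_law`).
[cite: Tao2016AveragedNS, §4 (4.8), the viscous equation before Thm. 4.2, §6.4; cell vocabulary (`UniformBound`)] -/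
theorem renormalisedViscousFlow_deriv_bound {ε₀ ν T C : ℝ} (hε : 0 < ε₀) (hν : 0 ≤ ν)
    {α : Fin m → Fin m → Fin m → ℤ × ℤ × ℤ → ℝ}
    {X : Fin m → ℤ → ℝ → ℝ} (hC1 : ∀ i n, ContDiffOn ℝ 1 (X i n) (Set.Ico 0 T))
    (hmot : ∀ i n t, 0 ≤ t → t < T → derivWithin (X i n) (Set.Ici 0) t =
      quadTerm ε₀ α X i n t - ν * (1 + ε₀) ^ ((2 : ℝ) * n) * X i n t)
    {W : ℤ → ℝ → Em m}
    (hW : ∀ n σ, W n σ = (bigLam ε₀ ^ n * Real.exp (-σ)) • shellVec X n (T - Real.exp (-σ)))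
    (htypeI : ∀ (n : ℤ) (t : ℝ), 0 ≤ t → t < T → bigLam ε₀ ^ n * (T - t) * ‖shellVec X n t‖ ≤ C)
    (n : ℤ) {σ : ℝ} (hσ : Real.exp (-σ) < T) :
    ∃ W' : Em m, HasDerivAt (W n) W' σ ∧
      ‖W'‖ ≤ C + (shiftConst α (0, 0, 0) + bigLam ε₀ * shiftConst α (0, 0, 1)) * C ^ 2
        + (bigLam ε₀)⁻¹ * (shiftConst α (1, 0, 0) + shiftConst α (0, 1, 0)) * C ^ 2
        + ν * ((1 + ε₀) ^ ((2 : ℝ) * n) * Real.exp (-σ)) * C := by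
  -- adapted from `renormalisedFlow_deriv_bound` (Theorems/…BlowupRigidityOneBlowupProfile.lean)
  have hL : 0 < bigLam ε₀ := bigLam_pos (by linarith)
  have hl0 : (0 : ℝ) < 1 + ε₀ := by linarith
  refine ⟨_, renormalisedViscousFlow_law hε hC1 hmot hW n hσ, ?_⟩
  have hbd : ∀ k : ℤ, ‖W k σ‖ ≤ C := fun k =>
    (uniformBound_iff_typeI (C := C) hε hW).2 htypeI k σ hσ.le
  have hC0 : 0 ≤ C := (norm_nonneg _).trans (hbd n)
  have h1 : ‖-((1 : ℝ) • W n σ)‖ ≤ C := by rw [norm_neg, one_smul]; exact hbd n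
  have h2 : ‖tableQ α (W n σ)‖ ≤ shiftConst α (0, 0, 0) * C ^ 2 :=
    (norm_tableQ_le α _).trans (mul_le_mul_of_nonneg_left
      (pow_le_pow_left₀ (norm_nonneg _) (hbd n) 2) (shiftConst_nonneg α _))
  have h3 : ‖bigLam ε₀ • tableA α (W (n - 1) σ)‖ ≤ bigLam ε₀ * (shiftConst α (0, 0, 1) * C ^ 2) := by
    rw [norm_smul, Real.norm_eq_abs, abs_of_pos hL]
    exact mul_le_mul_of_nonneg_left ((norm_tableA_le α _).trans (mul_le_mul_of_nonneg_left
      (pow_le_pow_left₀ (norm_nonneg _) (hbd (n - 1)) 2) (shiftConst_nonneg α _))) hL.le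
  have h4 : ‖(bigLam ε₀)⁻¹ • tableB α (W (n + 1) σ) (W n σ)‖ ≤
      (bigLam ε₀)⁻¹ * ((shiftConst α (1, 0, 0) + shiftConst α (0, 1, 0)) * C * C) := by
    rw [norm_smul, Real.norm_eq_abs, abs_of_pos (inv_pos.2 hL)]
    refine mul_le_mul_of_nonneg_left ((norm_tableB_le α _ _).trans ?_) (inv_pos.2 hL).le
    have hs : 0 ≤ shiftConst α (1, 0, 0) + shiftConst α (0, 1, 0) :=
      add_nonneg (shiftConst_nonneg α _) (shiftConst_nonneg α _)
    exact mul_le_mul (mul_le_mul_of_nonneg_left (hbd (n + 1)) hs) (hbd n) (norm_nonneg _)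
      (mul_nonneg hs hC0)
  have hcoef : 0 ≤ ν * ((1 + ε₀) ^ ((2 : ℝ) * n) * Real.exp (-σ)) :=
    mul_nonneg hν (mul_nonneg (Real.rpow_nonneg hl0.le _) (Real.exp_pos _).le)
  have h5 : ‖(ν * ((1 + ε₀) ^ ((2 : ℝ) * n) * Real.exp (-σ))) • W n σ‖ ≤
      ν * ((1 + ε₀) ^ ((2 : ℝ) * n) * Real.exp (-σ)) * C := by
    rw [norm_smul, Real.norm_eq_abs, abs_of_nonneg hcoef]
    exact mul_le_mul_of_nonneg_left (hbd n) hcoef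
  calc ‖-((1 : ℝ) • W n σ) + tableQ α (W n σ) + bigLam ε₀ • tableA α (W (n - 1) σ)
        + (bigLam ε₀)⁻¹ • tableB α (W (n + 1) σ) (W n σ)
        - (ν * ((1 + ε₀) ^ ((2 : ℝ) * n) * Real.exp (-σ))) • W n σ‖
      ≤ ‖-((1 : ℝ) • W n σ)‖ + ‖tableQ α (W n σ)‖ + ‖bigLam ε₀ • tableA α (W (n - 1) σ)‖
        + ‖(bigLam ε₀)⁻¹ • tableB α (W (n + 1) σ) (W n σ)‖
        + ‖(ν * ((1 + ε₀) ^ ((2 : ℝ) * n) * Real.exp (-σ))) • W n σ‖ := by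
          refine (norm_sub_le _ _).trans (add_le_add ?_ le_rfl)
          refine (norm_add_le _ _).trans (add_le_add ((norm_add_le _ _).trans
            (add_le_add (norm_add_le _ _) le_rfl)) le_rfl)
    _ ≤ C + shiftConst α (0, 0, 0) * C ^ 2 + bigLam ε₀ * (shiftConst α (0, 0, 1) * C ^ 2)
        + (bigLam ε₀)⁻¹ * ((shiftConst α (1, 0, 0) + shiftConst α (0, 1, 0)) * C * C)
        + ν * ((1 + ε₀) ^ ((2 : ℝ) * n) * Real.exp (-σ)) * C :=
          add_le_add (add_le_add (add_le_add (add_le_add h1 h2) h3) h4) h5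
    _ = _ := by ring

/-- **TYPE I ⇒ LIPSCHITZ ON THE HALF-LINE (viscous flow)**, with a constant depending on the shell through the viscosity:
`‖W_n(σ₂) − W_n(σ₁)‖ ≤ (K + ν(1+ε₀)^{2n}e^{−σ₁}C)(σ₂−σ₁)` for `σ₁ ≤ σ₂`, `e^{−σ₁} < T`.
[cite: Tao2016AveragedNS, §4, the viscous equation before Thm. 4.2, §6.4; Teschl2012, §2.6] -/
theorem renormalisedViscousFlow_lipschitz_of_typeI {ε₀ ν T C : ℝ} (hε : 0 < ε₀) (hν : 0 ≤ ν)
    {α : Fin m → Fin m → Fin m → ℤ × ℤ × ℤ → ℝ}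
    {X : Fin m → ℤ → ℝ → ℝ} (hC1 : ∀ i n, ContDiffOn ℝ 1 (X i n) (Set.Ico 0 T))
    (hmot : ∀ i n t, 0 ≤ t → t < T → derivWithin (X i n) (Set.Ici 0) t =
      quadTerm ε₀ α X i n t - ν * (1 + ε₀) ^ ((2 : ℝ) * n) * X i n t)
    {W : ℤ → ℝ → Em m}
    (hW : ∀ n σ, W n σ = (bigLam ε₀ ^ n * Real.exp (-σ)) • shellVec X n (T - Real.exp (-σ)))
    (htypeI : ∀ (n : ℤ) (t : ℝ), 0 ≤ t → t < T → bigLam ε₀ ^ n * (T - t) * ‖shellVec X n t‖ ≤ C)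
    (n : ℤ) {σ₁ σ₂ : ℝ} (hσ₁ : Real.exp (-σ₁) < T) (h12 : σ₁ ≤ σ₂) :
    ‖W n σ₂ - W n σ₁‖ ≤ (C + (shiftConst α (0, 0, 0) + bigLam ε₀ * shiftConst α (0, 0, 1)) * C ^ 2
        + (bigLam ε₀)⁻¹ * (shiftConst α (1, 0, 0) + shiftConst α (0, 1, 0)) * C ^ 2
        + ν * ((1 + ε₀) ^ ((2 : ℝ) * n) * Real.exp (-σ₁)) * C) * (σ₂ - σ₁) := by
  -- adapted from `renormalisedFlow_lipschitz_of_typeI` (Theorems/…BlowupRigidityOneBlowupProfile.lean)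
  have hl0 : (0 : ℝ) < 1 + ε₀ := by linarith
  set K : ℝ := C + (shiftConst α (0, 0, 0) + bigLam ε₀ * shiftConst α (0, 0, 1)) * C ^ 2
    + (bigLam ε₀)⁻¹ * (shiftConst α (1, 0, 0) + shiftConst α (0, 1, 0)) * C ^ 2 with hKdef
  have hhalf : ∀ τ ∈ Icc σ₁ σ₂, Real.exp (-τ) < T := fun τ hτ =>
    lt_of_le_of_lt (Real.exp_le_exp.2 (by linarith [hτ.1])) hσ₁
  choose D hD using fun τ : Icc σ₁ σ₂ =>
    renormalisedViscousFlow_deriv_bound hε hν hC1 hmot hW htypeI n (hhalf τ.1 τ.2)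
  have hC0 : 0 ≤ C := by
    have h := (hD ⟨σ₁, left_mem_Icc.2 h12⟩).2
    have hbd : ‖W n σ₁‖ ≤ C := (uniformBound_iff_typeI (C := C) hε hW).2 htypeI n σ₁ hσ₁.le
    exact (norm_nonneg _).trans hbd
  have hderiv : ∀ τ ∈ Icc σ₁ σ₂, HasDerivWithinAt (W n) (deriv (W n) τ) (Icc σ₁ σ₂) τ := by
    intro τ hτ
    exact ((hD ⟨τ, hτ⟩).1.differentiableAt.hasDerivAt).hasDerivWithinAt
  have hbound : ∀ τ ∈ Ico σ₁ σ₂, ‖deriv (W n) τ‖ ≤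
      K + ν * ((1 + ε₀) ^ ((2 : ℝ) * n) * Real.exp (-σ₁)) * C := by
    intro τ hτ
    have h := hD ⟨τ, Ico_subset_Icc_self hτ⟩
    rw [h.1.deriv]
    refine h.2.trans ?_
    have hexp : Real.exp (-τ) ≤ Real.exp (-σ₁) := Real.exp_le_exp.2 (by linarith [hτ.1])
    have : ν * ((1 + ε₀) ^ ((2 : ℝ) * n) * Real.exp (-τ)) * C ≤
        ν * ((1 + ε₀) ^ ((2 : ℝ) * n) * Real.exp (-σ₁)) * C :=
      mul_le_mul_of_nonneg_right (mul_le_mul_of_nonneg_left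
        (mul_le_mul_of_nonneg_left hexp (Real.rpow_nonneg hl0.le _)) hν) hC0
    rw [hKdef]; linarith
  exact norm_image_sub_le_of_norm_deriv_le_segment' hderiv hbound σ₂ (right_mem_Icc.2 h12)

/-! ### Type I ⇒ ω-limits exist and solve the viscous law with the limit viscosity -/

/-- **TYPE I ⇒ ω-LIMITS OF THE RENORMALISED VISCOUS FLOW EXIST AND SOLVE THE VISCOUS ETERNAL LAW ON ALL OF `ℝ`.**  Let `X` solve the
exact `ν`-viscous lattice on `[0,T)` (`ν ≥ 0`), `W̃` its renormalisation around `T`, with the type-I bound `Λ^n(T−t)‖x_n(t)‖ ≤ C`.  For shell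
centres `d_j ∈ ℤ` and log-time centres `s_j → +∞` whose FRAME VISCOSITIES `r_j = ν(1+ε₀)^{2d_j}e^{−s_j}` lie in `[0,K₁]`, there are a
subsequence `φ`, a limit viscosity `ν̂ ∈ [0,K₁]` with `r_{φ j} → ν̂`, and `W : ℤ → ℝ → ℝ^m` such that the translates `W̃_{n+d_{φ j}}(u+s_{φ j})`
converge continuously to `W`, `W` satisfies the law of `IsEternalVisc ε₀ ν̂ α` at EVERY `σ ∈ ℝ`, and `‖W_n(σ)‖ ≤ C`.
[cite: Tao2016AveragedNS, §6.4 with §4 (4.8) and the viscous equation before Thm. 4.2; KochNadirashviliSereginSverak2009, Thm 1.1 ff. (rescaling-compactness shape); Teschl2012, §2.6; cell vocabulary (`IsEternalVisc`, `UniformBound`)] -/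
theorem viscousEternalLawLimit_of_typeI {ε₀ ν T C K₁ : ℝ} (hε : 0 < ε₀) (hν : 0 ≤ ν) (hT : 0 < T)
    {α : Fin m → Fin m → Fin m → ℤ × ℤ × ℤ → ℝ}
    {X : Fin m → ℤ → ℝ → ℝ} (hC1 : ∀ i n, ContDiffOn ℝ 1 (X i n) (Set.Ico 0 T))
    (hmot : ∀ i n t, 0 ≤ t → t < T → derivWithin (X i n) (Set.Ici 0) t =
      quadTerm ε₀ α X i n t - ν * (1 + ε₀) ^ ((2 : ℝ) * n) * X i n t)
    {W : ℤ → ℝ → Em m}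
    (hW : ∀ n σ, W n σ = (bigLam ε₀ ^ n * Real.exp (-σ)) • shellVec X n (T - Real.exp (-σ)))
    (htypeI : ∀ (n : ℤ) (t : ℝ), 0 ≤ t → t < T → bigLam ε₀ ^ n * (T - t) * ‖shellVec X n t‖ ≤ C)
    (d : ℕ → ℤ) (s : ℕ → ℝ) (hs : Tendsto s atTop atTop)
    (hr : ∀ j, ν * (1 + ε₀) ^ ((2 : ℝ) * d j) * Real.exp (-(s j)) ∈ Icc 0 K₁) :
    ∃ φ : ℕ → ℕ, StrictMono φ ∧ ∃ νh : ℝ, νh ∈ Icc 0 K₁ ∧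
      Tendsto (fun j => ν * (1 + ε₀) ^ ((2 : ℝ) * d (φ j)) * Real.exp (-(s (φ j)))) atTop (𝓝 νh) ∧
      ∃ Wlim : ℤ → ℝ → Em m,
      (∀ (n : ℤ) (u : ℕ → ℝ) (σ : ℝ), Tendsto u atTop (𝓝 σ) →
        Tendsto (fun j => W (n + d (φ j)) (u j + s (φ j))) atTop (𝓝 (Wlim n σ))) ∧
      (∀ (n : ℤ) (σ : ℝ), HasDerivAt (Wlim n) (-((1 : ℝ) • Wlim n σ) + tableQ α (Wlim n σ)
        + bigLam ε₀ • tableA α (Wlim (n - 1) σ) + (bigLam ε₀)⁻¹ • tableB α (Wlim (n + 1) σ) (Wlim n σ)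
        - (νh * ((1 + ε₀) ^ ((2 : ℝ) * n) * Real.exp (-σ))) • Wlim n σ) σ) ∧
      (∀ (n : ℤ) (σ : ℝ), ‖Wlim n σ‖ ≤ C) := by
  -- adapted from `eternalLawLimit_of_typeI` (Theorems/…BlowupRigidityOneTypeIEternalLimit.lean)
  have hl0 : (0 : ℝ) < 1 + ε₀ := by linarith
  set r : ℕ → ℝ := fun j => ν * (1 + ε₀) ^ ((2 : ℝ) * d j) * Real.exp (-(s j)) with hr_def
  -- the receding thresholds of the translates
  set a : ℕ → ℝ := fun j => -Real.log T - s j with ha_def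
  have hwin : ∀ (j : ℕ) (u : ℝ), a j < u → Real.exp (-(u + s j)) < T := by
    intro j u hu
    have hu' : -(u + s j) < Real.log T := by
      have : -Real.log T - s j < u := hu
      linarith
    calc Real.exp (-(u + s j)) < Real.exp (Real.log T) := Real.exp_lt_exp.2 hu'
      _ = T := Real.exp_log hT
  have ha : Tendsto a atTop atBot := by
    refine tendsto_atBot.2 fun b => ?_
    exact (hs.eventually (eventually_ge_atTop (-Real.log T - b))).mono fun j hj => by
      show -Real.log T - s j ≤ b
      linarith
  -- the translates, their law, bound and Lipschitz constants
  set g : ℕ → ℤ → ℝ → Em m := fun j n u => W (n + d j) (u + s j) with hg_def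
  have hvisc : ∀ (j : ℕ) (n : ℤ) (u : ℝ),
      ν * ((1 + ε₀) ^ ((2 : ℝ) * ((n + d j : ℤ) : ℝ)) * Real.exp (-(u + s j))) =
        r j * ((1 + ε₀) ^ ((2 : ℝ) * n) * Real.exp (-u)) := by
    intro j n u
    simp only [hr_def]
    push_cast
    rw [show (2 : ℝ) * ((n : ℝ) + (d j : ℝ)) = 2 * (n : ℝ) + 2 * (d j : ℝ) by ring, Real.rpow_add hl0,
      show -(u + s j) = -u + -(s j) by ring, Real.exp_add]
    ring
  have hlawg : ∀ (j : ℕ) (n : ℤ) (u : ℝ), a j < u → HasDerivAt (g j n)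
      (-((1 : ℝ) • g j n u) + tableQ α (g j n u) + bigLam ε₀ • tableA α (g j (n - 1) u)
        + (bigLam ε₀)⁻¹ • tableB α (g j (n + 1) u) (g j n u)
        - (r j * ((1 + ε₀) ^ ((2 : ℝ) * n) * Real.exp (-u))) • g j n u) u := by
    intro j n u hu
    have h := (renormalisedViscousFlow_law hε hC1 hmot hW (n + d j) (hwin j u hu)).comp_add_const u (s j)
    have e1 : n + d j - 1 = n - 1 + d j := by ring
    have e2 : n + d j + 1 = n + 1 + d j := by ring
    rw [e1, e2, hvisc j n u] at h
    exact h
  have hbdg : ∀ (j : ℕ) (n : ℤ) (u : ℝ), a j < u → ‖g j n u‖ ≤ C := fun j n u hu =>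
    (uniformBound_iff_typeI (C := C) hε hW).2 htypeI (n + d j) (u + s j) (hwin j u hu).le
  set K : ℝ := C + (shiftConst α (0, 0, 0) + bigLam ε₀ * shiftConst α (0, 0, 1)) * C ^ 2
    + (bigLam ε₀)⁻¹ * (shiftConst α (1, 0, 0) + shiftConst α (0, 1, 0)) * C ^ 2 with hK_def
  have hC0 : 0 ≤ C := (norm_nonneg _).trans (hbdg 0 0 (a 0 + 1) (by linarith))
  have hK₁0 : 0 ≤ K₁ := (hr 0).1.trans (hr 0).2
  have hlipg : ∀ (j : ℕ) (n : ℤ) (u v : ℝ), a j < u → u ≤ v →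
      ‖g j n v - g j n u‖ ≤ (K + K₁ * ((1 + ε₀) ^ ((2 : ℝ) * n) * Real.exp (-u)) * C) * (v - u) := by
    intro j n u v hu huv
    have h := renormalisedViscousFlow_lipschitz_of_typeI hε hν hC1 hmot hW htypeI (n + d j) (hwin j u hu)
      (show u + s j ≤ v + s j by linarith)
    have e : v + s j - (u + s j) = v - u := by ring
    rw [e, hvisc j n u] at h
    refine h.trans (mul_le_mul_of_nonneg_right ?_ (by linarith))
    have hq : 0 ≤ (1 + ε₀) ^ ((2 : ℝ) * n) * Real.exp (-u) :=
      mul_nonneg (Real.rpow_nonneg hl0.le _) (Real.exp_pos _).le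
    have : r j * ((1 + ε₀) ^ ((2 : ℝ) * n) * Real.exp (-u)) * C ≤
        K₁ * ((1 + ε₀) ^ ((2 : ℝ) * n) * Real.exp (-u)) * C :=
      mul_le_mul_of_nonneg_right (mul_le_mul_of_nonneg_right (hr j).2 hq) hC0
    rw [hK_def]; linarith
  -- Arzelà–Ascoli with the viscosity parameter
  have hJ : ∀ a' : ℝ, ∃ J : ℕ, ∀ j, J ≤ j → a j < a' := fun a' =>
    eventually_atTop.1 (ha.eventually (eventually_lt_atBot a'))
  have hB : ∀ (n : ℤ) (a' : ℝ), ∃ C' : ℝ, ∃ J : ℕ, ∀ j, J ≤ j → ∀ u : ℝ, a' ≤ u → ‖g j n u‖ ≤ C' := by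
    intro n a'
    obtain ⟨J, hJ'⟩ := hJ a'
    exact ⟨C, J, fun j hj u hu => hbdg j n u (lt_of_lt_of_le (hJ' j hj) hu)⟩
  have hL : ∀ (n : ℤ) (a' : ℝ), ∃ K' : ℝ, ∃ J : ℕ, ∀ j, J ≤ j → ∀ u v : ℝ, a' ≤ u → a' ≤ v →
      ‖g j n u - g j n v‖ ≤ K' * |u - v| := by
    intro n a'
    obtain ⟨J, hJ'⟩ := hJ a'
    set K' : ℝ := K + K₁ * ((1 + ε₀) ^ ((2 : ℝ) * n) * Real.exp (-a')) * C with hK'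
    have hmono : ∀ u, a' ≤ u → K + K₁ * ((1 + ε₀) ^ ((2 : ℝ) * n) * Real.exp (-u)) * C ≤ K' := by
      intro u hu
      have hexp : Real.exp (-u) ≤ Real.exp (-a') := Real.exp_le_exp.2 (by linarith)
      have h1 : K₁ * ((1 + ε₀) ^ ((2 : ℝ) * n) * Real.exp (-u)) * C ≤
          K₁ * ((1 + ε₀) ^ ((2 : ℝ) * n) * Real.exp (-a')) * C :=
        mul_le_mul_of_nonneg_right (mul_le_mul_of_nonneg_left
          (mul_le_mul_of_nonneg_left hexp (Real.rpow_nonneg hl0.le ((2 : ℝ) * n))) hK₁0) hC0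
      rw [hK']; linarith
    refine ⟨K', J, fun j hj u v hu hv => ?_⟩
    rcases le_total u v with huv | hvu
    · rw [norm_sub_rev, abs_sub_comm, abs_of_nonneg (by linarith)]
      exact (hlipg j n u v (lt_of_lt_of_le (hJ' j hj) hu) huv).trans
        (mul_le_mul_of_nonneg_right (hmono u hu) (by linarith))
    · rw [abs_of_nonneg (by linarith)]
      exact (hlipg j n v u (lt_of_lt_of_le (hJ' j hj) hv) hvu).trans
        (mul_le_mul_of_nonneg_right (hmono v hv) (by linarith))
  obtain ⟨φ, hφ, ⟨νh, hνh, hrlim⟩, Wlim, hconv⟩ := exists_subseq_continuousLimit_param g hB hL r 0 K₁ hr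
  -- the limit solves the viscous law with `ν̂` (perturbation `(ν̂ - r_{φ j}) (1+ε₀)^{2n} e^{-u} • g`) and inherits the bound
  have ha' : Tendsto (fun j => a (φ j)) atTop atBot := ha.comp hφ.tendsto_atTop
  set V : ℕ → ℤ → ℝ → Em m := fun j => g (φ j) with hV
  set P : ℕ → ℤ → ℝ → Em m := fun j n u =>
    ((νh - r (φ j)) * ((1 + ε₀) ^ ((2 : ℝ) * n) * Real.exp (-u))) • g (φ j) n u with hP_def
  have hlawV : ∀ (j : ℕ) (n : ℤ) (u : ℝ), a (φ j) < u → HasDerivAt (V j n)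
      (-((1 : ℝ) • V j n u) + tableQ α (V j n u) + bigLam ε₀ • tableA α (V j (n - 1) u)
        + (bigLam ε₀)⁻¹ • tableB α (V j (n + 1) u) (V j n u)
        - (νh * ((1 + ε₀) ^ ((2 : ℝ) * n) * Real.exp (-u))) • V j n u + P j n u) u := by
    intro j n u hu
    have h := hlawg (φ j) n u hu
    refine h.congr_deriv ?_
    simp only [hV, hP_def]
    rw [sub_mul, sub_smul]
    abel
  have hPcont : ∀ (j : ℕ) (n : ℤ) (u : ℝ), a (φ j) < u → ContinuousAt (P j n) u := by
    intro j n u hu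
    have hgc : ContinuousAt (g (φ j) n) u := (hlawg (φ j) n u hu).continuousAt
    have hsc : ContinuousAt (fun u => (νh - r (φ j)) * ((1 + ε₀) ^ ((2 : ℝ) * n) * Real.exp (-u))) u := by
      fun_prop
    exact hsc.smul hgc
  have hPsmall : ∀ (n : ℤ) (a' e : ℝ), 0 < e → ∀ᶠ j in atTop, ∀ u : ℝ, a' ≤ u → ‖P j n u‖ ≤ e := by
    intro n a' e he
    set Q : ℝ := (1 + ε₀) ^ ((2 : ℝ) * n) * Real.exp (-a') * C + 1 with hQ
    have hQ0 : 0 < Q := by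
      have : 0 ≤ (1 + ε₀) ^ ((2 : ℝ) * n) * Real.exp (-a') * C :=
        mul_nonneg (mul_nonneg (Real.rpow_nonneg hl0.le _) (Real.exp_pos _).le) hC0
      rw [hQ]; linarith
    have hsmall : ∀ᶠ j in atTop, |νh - r (φ j)| < e / Q := by
      have h := (Metric.tendsto_nhds.1 hrlim) (e / Q) (div_pos he hQ0)
      exact h.mono fun j hj => by rw [abs_sub_comm]; rwa [Real.dist_eq] at hj
    obtain ⟨J, hJ'⟩ := hJ a'
    have hJev : ∀ᶠ j in atTop, a (φ j) < a' :=
      (eventually_ge_atTop J).mono fun j hj => hJ' (φ j) ((hj.trans (hφ.id_le j)))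
    filter_upwards [hsmall, hJev] with j hj hja u hu
    have hgb : ‖g (φ j) n u‖ ≤ C := hbdg (φ j) n u (lt_of_lt_of_le hja hu)
    have hcoef : |(νh - r (φ j)) * ((1 + ε₀) ^ ((2 : ℝ) * n) * Real.exp (-u))| ≤
        e / Q * ((1 + ε₀) ^ ((2 : ℝ) * n) * Real.exp (-a')) := by
      rw [abs_mul, abs_of_nonneg (mul_nonneg (Real.rpow_nonneg hl0.le _) (Real.exp_pos _).le)]
      exact mul_le_mul hj.le (mul_le_mul_of_nonneg_left (Real.exp_le_exp.2 (by linarith))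
        (Real.rpow_nonneg hl0.le _)) (mul_nonneg (Real.rpow_nonneg hl0.le _) (Real.exp_pos _).le)
        (div_pos he hQ0).le
    simp only [hP_def]
    rw [norm_smul, Real.norm_eq_abs]
    calc |(νh - r (φ j)) * ((1 + ε₀) ^ ((2 : ℝ) * n) * Real.exp (-u))| * ‖g (φ j) n u‖
        ≤ e / Q * ((1 + ε₀) ^ ((2 : ℝ) * n) * Real.exp (-a')) * C :=
          mul_le_mul hcoef hgb (norm_nonneg _) (by positivity)
      _ = e * (((1 + ε₀) ^ ((2 : ℝ) * n) * Real.exp (-a') * C) / Q) := by ring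
      _ ≤ e * 1 := by
          refine mul_le_mul_of_nonneg_left ?_ he.le
          rw [div_le_one hQ0, hQ]; linarith
      _ = e := mul_one e
  have hbdV : ∀ (n : ℤ) (a' : ℝ), ∃ B : ℝ, ∀ᶠ j in atTop, ∀ u : ℝ, a' ≤ u → ‖V j n u‖ ≤ B := by
    intro n a'
    obtain ⟨J, hJ'⟩ := hJ a'
    refine ⟨C, (eventually_ge_atTop J).mono fun j hj u hu => ?_⟩
    exact hbdg (φ j) n u (lt_of_lt_of_le (hJ' (φ j) (hj.trans (hφ.id_le j))) hu)
  have hbd' : ∀ (j : ℕ) (n : ℤ) (u : ℝ), a (φ j) < u → ‖V j n u‖ ≤ C := fun j n u hu =>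
    hbdg (φ j) n u hu
  refine ⟨φ, hφ, νh, hνh, hrlim, Wlim, fun n u σ hu => hconv n u σ hu, fun n σ => ?_, fun n σ => ?_⟩
  · exact viscousLaw_of_perturbedLimit_local (V := V) (P := P) hlawV hPcont hPsmall hbdV ha' hconv n σ
  · exact norm_limit_le_of_receding (V := V) hbd' ha' hconv n σ


end Summit.NavierStokesRegularity.NavierStokesRegularity.Theorems.EternalRigidityViscBddOne.ViscousLawLimit

end
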